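import Mathlib

/-!
# `Balaban1983to89.B5` — T. Balaban, *Propagators and renormalization transformations for lattice gauge
theories. I*, Commun. Math. Phys. **95**, 17–40 (1984).  (INDEX: B5; ref [2] = B4 = CMP 89 (1983).)
PDF held: `paper:balaban1984-cmp95-propagators-rt-i` (journal page = PDF page + 16).

CITATION HEADER (lean-in-tree rule 2026-08-18). This module is a TYPED SKELETON (statement level) of the published paper
T. Bałaban, "Propagators and renormalization transformations for lattice gauge theories. I", *Comm. Math. Phys.* **95**, 17–40 (1984) [Balaban1984PropagatorsI] (cell paper B5).
WHAT IS REPRODUCED: the main theorems/propositions as `def … : Prop` carrying the VERBATIM printed statement in the docstring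
(journal page + equation numbers), over abstract carrier structures whose Prop-valued fields name the printed hypotheses; plus a few
kernel-checked pieces of elementary arithmetic re-deriving printed constants (the audit's "second engine").  NOTHING of the series is
asserted: the series' end-statement (ultraviolet stability of 4-d lattice gauge theories, [Balaban1987RG1] Thm 2 ff.) is a CLAIM UNDER
ADJUDICATION by the audit cell `pub-balaban`; every `…Printed` Prop here is consumed downstream only as a hypothesis `(h : …Printed …)`.
The cell's line-by-line census of this paper (objections located to page/equation, certifications) is the cell's GAPS.md (ids quoted in
the docstrings: C-… certified, G-… objection/flag, D-… divergence row of the cell's DIVERGENCE.md).  Why local carrier structures and not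
the shared `Setup` vocabulary (`…Balaban1983to89.Setup`): this paper's statements quantify over operator KERNELS and norm functionals
(random-walk expansions, Hölder norms, weighted sup norms, quadratic forms) that `Setup` deliberately does not model; the carriers only
NAME those functionals as fields, so no `Setup` definition is restated here and nothing is defined twice.  Staged byte-identically in the
cell package `run/shared/lean/pub/pub-balaban/lean/BalabanYm4/Literature/MathematicalPhysics/QuantumFieldTheory/Balaban1983to89/B5.lean`
(legacy copy `BalabanYm4/B5.lean` there, namespace `BalabanYm4.B5`, same declarations).

Unit `b2b-balaban-r1` (reader group A).  STATEMENT LEVEL ONLY: Proposition 1.1 (p. 33, (1.89)–(1.90))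
and Proposition 1.2 (pp. 35–36, (1.110)–(1.114)) quoted VERBATIM, over an abstract carrier; a = 1; the
constants γ₀, δ₀, O(1) "depend on d only" = chosen before the instance (k, torus) for fixed d AND the fixed
L of the series (census C-B5-5: "depending on d only" silently includes L).  Also typed: the quadratic-form
bounds (1.67) (γ₀⟨∂₁B, ∂₁B⟩ ≤ ⟨B, Δ_kB⟩ ≤ γ₁⟨∂₁B, ∂₁B⟩, p. 29) consumed by B6 (2.118)/(2.153).
Main unwritten step of the paper (GAPS C-B5-6, p. 37: "We will be very sketchy …"): Prop. 1.2 for G₀ and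
(1.126)–(1.127) by analogy with B4.  Gauge-fixing passage (1.17) ⇒ (1.23): GAPS G-B5-01.
KERNEL-CHECKED: the operator-monotonicity bookkeeping (1.89) ⇒ (1.90) in its scalar form.
Companion prose: `HOME/b2b-balaban-r1/B5.md`, `B4-leaves.md` (quoted B4 leaves L-B4-1…4).
Phase 2 (unit `b2b-balaban-b05`, whole-paper sub-cell, 2026-08-18): section `## Phase 2` below — the lemma behind
G-B5-01 (ii) kernel-checked (`HierGauge.complete`/`unique`), the algebra of (1.95)/(1.103), (1.122)–(1.123),
(1.132)–(1.133) and the decay-extraction step of (1.131) kernel-checked, the displayed claims of pp. 25–26, 29, 36, 38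
typed verbatim, Prop. 1.2 assembled from its printed steps (`prop12_of_printed_steps`), the printed γ₁ = a⁻² of p. 26
refuted for large a with the provable replacement (G-B5-13); companion prose `HOME/b2b-balaban-b05/` (GAPS rows
G-B5-01R, C-B5-7 … C-B5-12, G-B5-13, G-B5-14, G-B5-06a; numerics `num/`).
-/

namespace Literature.MathematicalPhysics.QuantumFieldTheory.Balaban1983to89.B5

/-- Abstract carrier for Props 1.1–1.2 on the torus T_η (η = L^{−k}), unit cubes Δ(y), y ∈ T₁^{(k)}, and
their doubled cubes Δ̃(y): arguments J (`Loc`), `suppIn J y′` = supp J ⊂ Δ̃(y′), norms |J| (`supNorm`),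
‖J‖ (`l2Norm`), ‖J‖_ε (`holder`), cut-offs ζ ∈ C₀^∞(Δ̃(y)) (`Cut`, `cutIn`, `cutH α ζ` = ‖ζ‖_α + |ζ|,
`cutSup ζ` = |ζ|), unit-lattice distance |y − y′| (`dist`). The operator G = G_k = Δ_a^{−1} (1.71) is seen
through: `l2op n J` = the six L² norms of (1.89) (‖GJ‖, ‖∇GJ‖, ‖G∇*J‖, ‖∇G∇*J‖, ‖∇∇GJ‖, ‖G∇*∇*J‖);
`e n J y` (n = 0…3) = sup_{x∈Δ̃(y)} of |(GJ)(x)|, |(∇GJ)(x)|, |(G∇*J)(x)|, |(ΔGJ)(x)| (1.110); `h1 J α ζ` =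
max(‖ζ∇GJ‖_α, ‖ζG∇*J‖_α) (1.111); `e4 J y` = sup |(∇G∇*J)(x)| (1.112); `h2 J α ζ` = ‖ζ∇G∇*J‖_α (1.113);
`l2loc n J ζ` = the six localised L² norms of (1.114). [cite: Balaban1984PropagatorsI, §1 (1.64)–(1.71) pp.29–33] -/
structure Setting where
  Site : Type
  dist : Site → Site → ℝ
  k : ℕ
  Loc : Type
  suppIn : Loc → Site → Prop
  supNorm : Loc → ℝ
  l2Norm : Loc → ℝ
  holder : ℝ → Loc → ℝ
  Cut : Type
  cutIn : Cut → Site → Prop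
  cutH : ℝ → Cut → ℝ
  cutSup : Cut → ℝ
  l2op : Fin 6 → Loc → ℝ
  e : Fin 4 → Loc → Site → ℝ
  h1 : Loc → ℝ → Cut → ℝ
  e4 : Loc → Site → ℝ
  h2 : Loc → ℝ → Cut → ℝ
  l2loc : Fin 6 → Loc → Cut → ℝ
  /-- the quadratic forms ⟨A, Δ_aA⟩ and ⟨A, (Δ + I)A⟩ on vector fields A (for (1.90)) -/
  Vec : Type
  formΔa : Vec → ℝ
  formΔI : Vec → ℝ

variable {I : Type}

/-- **Proposition 1.1** (p. 33 [PDF 17], verbatim): *"The operator G is a symmetric operator on L²(T_η) and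
‖GJ‖, ‖∇GJ‖, ‖G∇*J‖, ‖∇G∇*J‖, ‖∇∇GJ‖, ‖G∇*∇*J‖ ≤ γ₀^{−1}‖J‖, (1.89) with a positive constant γ₀ independent
of k, T_η, and depending on d only (if we put a = 1).  This implies the bound from below:
Δ_a = G^{−1} ≥ γ₀(Δ + I). (1.90)"*  (GAPS C-B5-4: the proof pp. 31–33 is a sketch of a finite multiplier
computation; (1.89) ⇒ (1.90) holds with γ₀ relabelled γ₀/C(d).)  Family index `I` = (k, T_η). [cite: Balaban1984PropagatorsI, Prop. 1.1 (1.89)–(1.90) p.33] -/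
def Prop11Printed (fam : I → Setting) : Prop :=
  ∃ γ₀ : ℝ, 0 < γ₀ ∧ ∀ i : I,
    (∀ (n : Fin 6) (J : (fam i).Loc), (fam i).l2op n J ≤ γ₀⁻¹ * (fam i).l2Norm J) ∧
    (∀ A : (fam i).Vec, γ₀ * (fam i).formΔI A ≤ (fam i).formΔa A)

/-- C-B5-4, kernel-checked scalar bookkeeping of (1.89) ⇒ (1.90): for commuting positive quantities, if
(t + 1) ≤ Cγ₀^{−1}·s (the content of ‖(Δ + I)GJ‖ ≤ C(d)γ₀^{−1}‖J‖ on a joint spectral value t of Δ and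
s of Δ_a) then (γ₀/C)(t + 1) ≤ s — i.e. (1.90) with γ₀ replaced by γ₀/C(d). [folklore] -/
theorem lower_bound_relabelled (γ₀ C t s : ℝ) (hγ : 0 < γ₀) (hC : 0 < C)
    (h : t + 1 ≤ C * γ₀⁻¹ * s) : γ₀ / C * (t + 1) ≤ s := by
  have h1 : γ₀ / C * (t + 1) ≤ γ₀ / C * (C * γ₀⁻¹ * s) :=
    mul_le_mul_of_nonneg_left h (by positivity)
  have h2 : γ₀ / C * (C * γ₀⁻¹ * s) = s := by field_simp
  linarith [h1, h2.le, h2.ge]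

/-- prefactor-free entries here (unit lattice after rescaling: Prop. 1.2 is stated on T_η with unit cubes,
no scale factors). The four sup entries (1.110) and six L² entries (1.114). [cite: Balaban1984PropagatorsI, (1.110)–(1.114) pp.35–36] -/
def Ineq110_114 (S : Setting) (C : ℝ) (Cα Cε : ℝ → ℝ) (Cαε : ℝ → ℝ → ℝ) (δ₀ : ℝ) : Prop :=
  (∀ (n : Fin 4) (J : S.Loc) (y y' : S.Site), S.suppIn J y' →
      S.e n J y ≤ C * Real.exp (-(δ₀ * S.dist y y')) * S.supNorm J) ∧
  (∀ (α : ℝ) (J : S.Loc) (ζ : S.Cut) (y y' : S.Site), 0 ≤ α → α < 1 → S.cutIn ζ y → S.suppIn J y' →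
      S.h1 J α ζ ≤ Cα α * Real.exp (-(δ₀ * S.dist y y')) * S.cutH α ζ * S.supNorm J) ∧
  (∀ (ε : ℝ) (J : S.Loc) (y y' : S.Site), 0 < ε → ε < 1 → S.suppIn J y' →
      S.e4 J y ≤ Cε ε * Real.exp (-(δ₀ * S.dist y y')) * (S.holder ε J + S.supNorm J)) ∧
  (∀ (α ε : ℝ) (J : S.Loc) (ζ : S.Cut) (y y' : S.Site), 0 ≤ α → 0 < ε → α + ε < 1 →
      S.cutIn ζ y → S.suppIn J y' →
      S.h2 J α ζ ≤ Cαε α ε * Real.exp (-(δ₀ * S.dist y y')) * S.cutH α ζ *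
        (S.holder (α + ε) J + S.supNorm J)) ∧
  (∀ (n : Fin 6) (J : S.Loc) (ζ : S.Cut) (y y' : S.Site), S.cutIn ζ y → S.suppIn J y' →
      S.l2loc n J ζ ≤ C * Real.exp (-(δ₀ * S.dist y y')) * S.cutSup ζ * S.l2Norm J)

/-- **Proposition 1.2** (pp. 35–36 [PDF 19–20], verbatim): *"There exists a positive constant δ₀ depending on d
only, such that |(GJ)(x)|, |(∇GJ)(x)|, |(G∇*J)(x)|, |(ΔGJ)(x)| ≤ O(1)e^{−δ₀|y−y′|}|J| (1.110) for x ∈ Δ̃(y),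
supp J ⊂ Δ̃(y′), with the constant O(1) depending on d only, ‖ζ∇GJ‖_α, ‖ζG∇*J‖_α ≤ O(1)e^{−δ₀|y−y′|}(‖ζ‖_α +
|ζ|)|J| (1.111) for 0 ≤ α < 1, ζ ∈ C₀^∞(Δ̃(y)), supp J ⊂ Δ̃(y′), with the constant O(1) depending on d and α
(O(1) → ∞ if α → 1), |(∇G∇*J)(x)| ≤ O(1)e^{−δ₀|y−y′|}(‖J‖_ε + |J|) (1.112) for 0 < ε < 1, x ∈ Δ̃(y), supp J ⊂
Δ̃(y′), with the constant O(1) depending on d and ε (O(1) → ∞ if ε → 0), ‖ζ∇G∇*J‖_α ≤ O(1)e^{−δ₀|y−y′|}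
(‖ζ‖_α + |ζ|)(‖J‖_{α+ε} + |J|) (1.113) for 0 ≤ α < 1, ε > 0, α + ε < 1, ζ ∈ C₀^∞(Δ̃(y)), supp J ⊂ Δ̃(y′),
with the constant O(1) depending on d, α and ε (O(1) → ∞ if α → 1 or ε → 0).  Finally there exists a
constant O(1) such that ‖ζGJ‖, ‖ζ∇GJ‖, ‖ζG∇*J‖, ‖ζ∇G∇*J‖, ‖ζ∇∇GJ‖, ‖ζG∇*∇*J‖ ≤ O(1)e^{−δ₀|y−y′|}|ζ|‖J‖
(1.114) for supp ζ ⊂ Δ̃(y), supp J ⊂ Δ̃(y′)."*  Quantifier order: δ₀, O(1), O(1)(α), O(1)(ε), O(1)(α, ε)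
chosen before the instance i = (k, T_η).  GAPS C-B5-6: proof for G₀ / (1.126)–(1.127) by analogy with B4. [cite: Balaban1984PropagatorsI, Prop. 1.2 (1.110)–(1.114) pp.35–36] -/
def Prop12Printed (fam : I → Setting) : Prop :=
  ∃ δ₀ C : ℝ, ∃ Cα Cε : ℝ → ℝ, ∃ Cαε : ℝ → ℝ → ℝ, 0 < δ₀ ∧ 0 < C ∧
    ∀ i : I, Ineq110_114 (fam i) C Cα Cε Cαε δ₀

/-- Abstract carrier of the unit-lattice quadratic form of the k-th step, (1.64)–(1.67) p. 29:
((ST)^k e^{−S})(B) = Z_k exp(−½⟨∂H_kB, ∂H_kB⟩), ⟨B, Δ_kB⟩ = ⟨∂H_kB, ∂H_kB⟩; `formΔk B` = ⟨B, Δ_kB⟩,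
`d1Sq B` = ⟨∂₁B, ∂₁B⟩ on the unit lattice T₁^{(k)}. [cite: Balaban1984PropagatorsI, (1.64)–(1.67) p.29] -/
structure FormData where
  Cfg : Type
  formΔk : Cfg → ℝ
  d1Sq : Cfg → ℝ

/-- **(1.67)** p. 29 [PDF 13] (verbatim): *"γ₀⟨∂₁B, ∂₁B⟩ ≤ ⟨B, Δ_kB⟩ ≤ γ₁⟨∂₁B, ∂₁B⟩, γ₀, γ₁ > 0 depending on d
only."*  (Consumed by B6 (2.118), (2.153).) [cite: Balaban1984PropagatorsI, (1.67) p.29] -/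
def Bounds167 (fam : I → FormData) : Prop :=
  ∃ γ₀ γ₁ : ℝ, 0 < γ₀ ∧ 0 < γ₁ ∧ ∀ i : I, ∀ B : (fam i).Cfg,
    γ₀ * (fam i).d1Sq B ≤ (fam i).formΔk B ∧ (fam i).formΔk B ≤ γ₁ * (fam i).d1Sq B

/-- The global consequences (1.115) of Prop. 1.2 (p. 36): |GJ|, |∇GJ|, |G∇*J|, |ΔGJ| ≤ O(1)|J| — obtained by
summing (1.110) over y′ with Σ_{y′} e^{−δ₀|y−y′|} < ∞.  Kernel-checked in the abstract form actually used:
a kernel bound with a summable majorant gives a global bound with constant C·S. [folklore] -/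
theorem global_of_local {Site : Type} [Fintype Site] (w : Site → Site → ℝ) (S C : ℝ)
    (hS : ∀ y, ∑ y', w y y' ≤ S) (hC : 0 ≤ C) (f : Site → Site → ℝ) (a : Site → ℝ) (ha : ∀ y', 0 ≤ a y')
    (hw : ∀ y y', 0 ≤ w y y') (hloc : ∀ y y', f y y' ≤ C * w y y' * a y') (amax : ℝ)
    (hamax : ∀ y', a y' ≤ amax) :
    ∀ y, ∑ y', f y y' ≤ C * S * amax := by
  intro y
  have hamax0 : 0 ≤ amax := by
    rcases isEmpty_or_nonempty Site with h | ⟨⟨y0⟩⟩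
    · exact le_trans (le_refl 0) (by
        have := hS y; simp at this; exact le_trans (ha y) (hamax y))
    · exact le_trans (ha y0) (hamax y0)
  calc ∑ y', f y y' ≤ ∑ y', C * w y y' * amax := by
        refine Finset.sum_le_sum fun y' _ => (hloc y y').trans ?_
        exact mul_le_mul_of_nonneg_left (hamax y') (mul_nonneg hC (hw y y'))
    _ = C * amax * ∑ y', w y y' := by rw [Finset.mul_sum]; refine Finset.sum_congr rfl fun y' _ => by ring
    _ ≤ C * amax * S := mul_le_mul_of_nonneg_left (hS y) (mul_nonneg hC hamax0)
    _ = C * S * amax := by ring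


/-! ## Phase 2 (paper sub-cell `b2b-balaban-b05`, 2026-08-18): the remaining displayed claims typed; the paper-internal
bookkeeping kernel-checked

Section map of the paper (journal pages; PDF page = journal page − 16): A (1.1)–(1.15) pp. 17–20 · B (1.16)–(1.20)
p. 20 · C "Change of gauge" (1.21)–(1.45) pp. 20–26 · D "Operators H_k and a calculation of the actions" (1.46)–(1.67)
pp. 26–29 · E "Operators G" (1.68)–(1.107) pp. 29–35 · F "Regularity and decay properties of G" (1.108)–(1.137)
pp. 35–40 (the number (1.124) is skipped in print).  The paper has exactly two named statements (Props. 1.1, 1.2,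
typed above by unit r1); everything below concerns displayed claims of the running text and the STRUCTURE of the
proof of Prop. 1.2 as the text states it.  Value = typed skeleton + census, NOT summit progress.
* `HierGauge.*` — the finite-dimensional lemma behind GAPS G-B5-01 (ii) (passage (1.17) ⇒ (1.23), pp. 20–21):
  hierarchical block-mean families with top value 0 are in bijection with admissible block-axial data
  (`complete`, `unique`, `reconstruct`).  KERNEL-CHECKED over abstract nested block maps — GAPS G-B5-01R.
* `hk_props` — (1.95) & (1.103) ⇒ Q_kH_k = I, R∂*H_k = 0 (pp. 33–34); `resolvent_identity` — the algebra of
  (1.132)/(1.133) (p. 39); `neumann_resummation` — (1.122) ⇒ (1.123) G = C₀(I − R)⁻¹ (p. 37);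
  `chain_split` — the decay-extraction step inside (1.131) (pp. 38–39); `bound145_scalar` /
  `printed_gamma1_fails` — the arithmetic of GAPS G-B5-13 (the printed γ₁ = a⁻² of p. 26 versus the provable
  γ₁ = (π/2)^{2d+2}a⁻²).
* `Bounds145Printed`, `HkPropsPrinted`, `Global115_117`, `Local114`, `Kernel126_127Printed` — the displayed
  claims of pp. 25–26, 29, 36, 38 verbatim over abstract carriers, and `prop12_of_printed_steps` — Prop. 1.2 from its
  printed steps S1 (p. 36), S1′/S2 (p. 39), S3 (pp. 39–40) chained exactly as the text chains them (each step's
  analytic content stays a hypothesis; (1.126)–(1.127) is the by-method import from [2] = B4, GAPS C-B5-6/G-B5-06a).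
Numerical census of Sects. C–E (two engines — exact rationals in position space and floating-point momentum
formulas; kit job j038533; cell files `HOME/b2b-balaban-b05/num/`): (1.16), (1.45), (1.55), (1.60), (1.63) 2nd form,
(1.66), (1.83)–(1.84) as printed, (1.99), (1.100), (1.103), (1.134) agree to ≤ 3·10⁻¹² (d = 2, 3, 4; L = 2, 3; k ≤ 4);
the FIRST expression of (1.63) carries misplaced conjugation bars (GAPS G-B5-14, print slip; the second, used, form is
right); the six norms of (1.89) converge geometrically in k (d = 2, L = 2: ‖∇∇G‖ = 32.0, 60.0, 71.1, 73.9 for k = 1…4)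
and are N-independent (C-B5-4a).
-/

/-! ### C.1  Hierarchical block-axial gauge: the lemma behind (1.17) ⇒ (1.23)  (GAPS G-B5-01R) -/

namespace HierGauge

/-! DICTIONARY.  Levels `j = 0 … k`: `X j` = the sites of the `L^jη`-lattice (`X 0` = T_η, η = L^{−k}; `X k` = the
unit lattice T₁^{(k)}); `π j : X j → X (j+1)` = the block map x ↦ y with x ∈ B(y) ((1.6), (1.18)); `r j : X (j+1) → X j`
= the block's base point (the lattices are nested, T^{(j+1)} ⊂ T^{(j)}, so r j y = y and `π j (r j y) = y` — hypothesis
`hsec`).  For a gauge function λ on T_η put `g j := Q′_jλ` (the j-fold scalar block average (1.20); with the paper's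
normalisation (Q′f)(y) = Σ_{x∈B(y)} (L^jη)^d … each step is the plain block MEAN, `fmean`), so `IsHier π k g`; the
residual group of (1.17) is N(Q′_k) = {λ : Q′_kλ = 0} = {g k = 0} (p. 20: "we can look at the integral (1.17) as obtained
by removing the gauge freedom … by gauge transformations λ satisfying Q′_kλ = 0").  The axial δ-functions δ_Ax(Q_jA^λ)
of (1.17) ((1.10): A(Γ_{y,x}) = 0, x ∈ B(y)) read, by (1.20) Q_jA^λ = Q_jA − ∂^{(j)}Q′_jλ, as
(Q′_jλ)(x) − (Q′_jλ)(y) = (L^jη)·(Q_jA)(Γ_{y,x}), i.e. `axData π r j (g j) x = a j x` with the ADMISSIBLE data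
a j x := (L^jη)(Q_jA)(Γ_{r(πx),x}) (a j (r j y) = 0: empty contour — hypothesis `ha`).  CLAIM G-B5-01 (ii) = for every A
there is exactly one λ ∈ N(Q′_k) putting all Q_jA^λ, j < k, in the block axial gauge = `complete` (existence, by the
top-down recursion `build`) + `unique` (two hierarchical families with the same top and the same axial data agree at
every level ≤ k, in particular at level 0, i.e. λ = λ′).  The statement is linear, so 𝔤-valued λ reduce to ℝ-valued
components.  What is NOT formalised: the identification of the paper's lattices/averages with (X, π, r) (routine) and
the Faddeev–Popov bookkeeping of the Jacobians (constants z^{(k)} → z′^{(k)}, immaterial: only gauge-invariant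
densities are evaluated, (1.15)). -/

variable {X : ℕ → Type} [∀ j, Fintype (X j)] [∀ j, DecidableEq (X j)]

/-- The block of `y ∈ X (j+1)`: the level-`j` sites that the block map sends to `y` (B^j(y), (1.6)/(1.18)). [cite: Balaban1984PropagatorsI, (1.6) p.18 and (1.18) p.20] -/
def fib (π : ∀ j, X j → X (j + 1)) (j : ℕ) (y : X (j + 1)) : Finset (X j) :=
  Finset.univ.filter fun x => π j x = y

/-- Block mean of a level-`j` function (one scalar averaging step Q′, (1.20), as a mean). [cite: Balaban1984PropagatorsI, (1.20) p.20] -/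
noncomputable def fmean (π : ∀ j, X j → X (j + 1)) (j : ℕ) (f : X j → ℝ) (y : X (j + 1)) : ℝ :=
  (∑ x ∈ fib π j y, f x) / (fib π j y).card

/-- Block-axial data of a level-`j` function relative to the base points `r`: f x − f (r (π x))
(the differences fixed by the axial δ-functions (1.10) inside each block). [cite: Balaban1984PropagatorsI, (1.10) p.19] -/
def axData (π : ∀ j, X j → X (j + 1)) (r : ∀ j, X (j + 1) → X j) (j : ℕ) (f : X j → ℝ) (x : X j) : ℝ :=
  f x - f (r j (π j x))

/-- `g` is hierarchical below level `k`: each level is the block mean of the previous one (Q′_{j+1} = Q′Q′_j,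
the scalar analogue of (1.16)). [cite: Balaban1984PropagatorsI, (1.16)–(1.20) p.20] -/
def IsHier (π : ∀ j, X j → X (j + 1)) (k : ℕ) (g : ∀ j, X j → ℝ) : Prop :=
  ∀ j, j < k → ∀ y, g (j + 1) y = fmean π j (g j) y

variable (π : ∀ j, X j → X (j + 1)) (r : ∀ j, X (j + 1) → X j)

/-- a site lies in the block it is mapped to. [folklore] -/
theorem mem_fib_self (j : ℕ) (x : X j) : x ∈ fib π j (π j x) := by simp [fib]

/-- with base points (a section of the block map) every block is nonempty. [folklore] -/
theorem fib_nonempty_of_section (hsec : ∀ j y, π j (r j y) = y) (j : ℕ) (y : X (j + 1)) :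
    (fib π j y).Nonempty := ⟨r j y, by simp [fib, hsec]⟩

/-- mean over a nonempty block of (a function of the block) + v = that function + mean of v. [folklore] -/
theorem fmean_lift_add (j : ℕ) (u : X (j + 1) → ℝ) (v : X j → ℝ) (y : X (j + 1))
    (hy : (fib π j y).Nonempty) :
    fmean π j (fun x => u (π j x) + v x) y = u y + fmean π j v y := by
  have hc : ((fib π j y).card : ℝ) ≠ 0 := by
    exact_mod_cast Finset.card_ne_zero.mpr hy
  have hconst : ∀ x ∈ fib π j y, u (π j x) = u y := by
    intro x hx
    simp only [fib, Finset.mem_filter, Finset.mem_univ, true_and] at hx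
    rw [hx]
  unfold fmean
  rw [Finset.sum_add_distrib, Finset.sum_congr rfl hconst, Finset.sum_const, nsmul_eq_mul, add_div]
  have : ((fib π j y).card : ℝ) * u y / (fib π j y).card = u y := by field_simp
  rw [this]

/-- block mean of the axial data = block mean − value at the base point. [folklore] -/
theorem fmean_axData (hsec : ∀ j y, π j (r j y) = y) (j : ℕ) (f : X j → ℝ) (y : X (j + 1)) :
    fmean π j (axData π r j f) y = fmean π j f y - f (r j y) := by
  have h : axData π r j f = fun x => (fun y' => -f (r j y')) (π j x) + f x := by
    funext x; simp only [axData]; ring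
  rw [h, fmean_lift_add π j (fun y' => -f (r j y')) f y (fib_nonempty_of_section π r hsec j y)]
  ring

/-- Every level-`j` function is recovered from its block mean and its block-axial data. [folklore] -/
theorem reconstruct (hsec : ∀ j y, π j (r j y) = y) (j : ℕ) (f : X j → ℝ) (x : X j) :
    f x = fmean π j f (π j x) + axData π r j f x - fmean π j (axData π r j f) (π j x) := by
  rw [fmean_axData π r hsec]
  simp only [axData]
  ring

omit [∀ j, Fintype (X j)] [∀ j, DecidableEq (X j)] in
/-- Block-axial data vanish at base points: the admissibility condition `ha` of `complete` is necessary. [folklore] -/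
theorem axData_base (hsec : ∀ j y, π j (r j y) = y) (j : ℕ) (f : X j → ℝ) (y : X (j + 1)) :
    axData π r j f (r j y) = 0 := by
  simp [axData, hsec]

/-- UNIQUENESS: two hierarchical families with the same top level `k` and the same block-axial data at all levels
`< k` agree at every level `≤ k` (so λ ∈ N(Q′_k) is determined by the axial data of the Q_jA^λ: the residual gauge
freedom left by the block axial δ-functions of (1.17) inside N(Q′_k) is trivial). [folklore] -/
theorem unique (hsec : ∀ j y, π j (r j y) = y) (k : ℕ) (g g' : ∀ j, X j → ℝ)
    (hg : IsHier π k g) (hg' : IsHier π k g') (htop : g k = g' k)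
    (hdata : ∀ j, j < k → ∀ x, axData π r j (g j) x = axData π r j (g' j) x) :
    ∀ j, j ≤ k → g j = g' j := by
  suffices h : ∀ n j, j + n = k → g j = g' j from fun j hj => h (k - j) j (by omega)
  intro n
  induction n with
  | zero =>
    intro j hj
    rw [Nat.add_zero] at hj
    subst hj
    exact htop
  | succ n ih =>
    intro j hj
    have hjk : j < k := by omega
    have hup : g (j + 1) = g' (j + 1) := ih (j + 1) (by omega)
    funext x
    have e1 : fmean π j (g j) (π j x) = fmean π j (g' j) (π j x) := by
      rw [← hg j hjk, ← hg' j hjk, hup]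
    have e2 : axData π r j (g j) = axData π r j (g' j) := funext (hdata j hjk)
    rw [reconstruct π r hsec j (g j) x, reconstruct π r hsec j (g' j) x, e1, e2]

/-- Top-down construction of the hierarchical family with prescribed block-axial data `a` and top value 0
("fix λ level by level, from the unit lattice down to T_η"). [folklore] -/
noncomputable def build (k : ℕ) (a : ∀ j, X j → ℝ) (j : ℕ) (x : X j) : ℝ :=
  if _h : j < k then build k a (j + 1) (π j x) + a j x - fmean π j (a j) (π j x) else 0
termination_by k - j
decreasing_by omega

/-- unfolding of `build` below the top level. [folklore] -/
theorem build_of_lt (k : ℕ) (a : ∀ j, X j → ℝ) {j : ℕ} (hj : j < k) (x : X j) :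
    build π k a j x = build π k a (j + 1) (π j x) + a j x - fmean π j (a j) (π j x) := by
  conv_lhs => rw [build]
  simp [hj]

/-- `build` vanishes at the top level k (λ ∈ N(Q′_k)). [folklore] -/
theorem build_top (k : ℕ) (a : ∀ j, X j → ℝ) (x : X k) : build π k a k x = 0 := by
  conv_lhs => rw [build]
  simp

/-- `build` is hierarchical. [folklore] -/
theorem build_hier (hsec : ∀ j y, π j (r j y) = y) (k : ℕ) (a : ∀ j, X j → ℝ) :
    IsHier π k (build π k a) := by
  intro j hj y
  have h : build π k a j =
      fun x => (fun y' => build π k a (j + 1) y' - fmean π j (a j) y') (π j x) + a j x := by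
    funext x
    rw [build_of_lt π k a hj]
    ring
  rw [h, fmean_lift_add π j (fun y' => build π k a (j + 1) y' - fmean π j (a j) y') (a j) y
    (fib_nonempty_of_section π r hsec j y)]
  ring

/-- `build` realises the prescribed admissible axial data. [folklore] -/
theorem build_data (hsec : ∀ j y, π j (r j y) = y) (k : ℕ) (a : ∀ j, X j → ℝ)
    (ha : ∀ j, j < k → ∀ y, a j (r j y) = 0) {j : ℕ} (hj : j < k) (x : X j) :
    axData π r j (build π k a j) x = a j x := by
  simp only [axData]
  rw [build_of_lt π k a hj x, build_of_lt π k a hj (r j (π j x)), hsec, ha j hj]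
  ring

/-- **G-B5-01R — EXISTENCE (completeness of the hierarchical block-axial gauge).**  For admissible axial data `a`
(vanishing at base points) there is a hierarchical family with top level 0 realising them; with `unique` this is the
finite-dimensional lemma GAPS G-B5-01 asks for: λ ↦ (block-axial data of Q_jA^λ)_{j<k} is a bijection from N(Q′_k)
onto the admissible data, so the axial δ-functions of (1.17) are a complete gauge fixing of exactly N(Q′_k) and the
Faddeev–Popov passage to (1.23) changes the integral of a gauge-invariant density by a constant only. [folklore] -/
theorem complete (hsec : ∀ j y, π j (r j y) = y) (k : ℕ) (a : ∀ j, X j → ℝ)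
    (ha : ∀ j, j < k → ∀ y, a j (r j y) = 0) :
    ∃ g : ∀ j, X j → ℝ, (∀ x, g k x = 0) ∧ IsHier π k g ∧
      ∀ j, j < k → ∀ x, axData π r j (g j) x = a j x :=
  ⟨build π k a, build_top π k a, build_hier π r hsec k a, fun _ hj x => build_data π r hsec k a ha hj x⟩

end HierGauge

/-! ### C.2  The bounds on Q′_kG′_k²Q′_k* (pp. 25–26) -/

/-- Carrier for (1.43)–(1.45) and the sentence after (1.45): configurations ω on the unit lattice T₁^{(k)} (`Cfg`),
the parameter a > 0 of Δ′_a = Δ + aQ′_k*Q′_k, G′_k = (Δ′_a)⁻¹ (p. 25), the quadratic form `qf ω` = ⟨ω, Q′_kG′_k²Q′_k*ω⟩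
and ‖ω‖² (`nsq`). [cite: Balaban1984PropagatorsI, (1.42)–(1.45) pp.25–26] -/
structure ProjFormData where
  Cfg : Type
  a : ℝ
  qf : Cfg → ℝ
  nsq : Cfg → ℝ

/-- p. 25 [PDF 9] "We have bounds 0 < Q′_kG′_k²Q′_k* ≤ a⁻², and they imply the existence of the inverse operator and a
bound from below" and p. 26 [PDF 10], after (1.45), verbatim: *"From this representation and from the bounds (2.51),
(2.52) of that paper, it follows that there are positive constants γ₀, γ₁, in fact γ₀ dependent only on d, γ₁ = a⁻²,
such that γ₀ ≤ Q′_kG′_k²Q′_k* ≤ γ₁."*  AS PRINTED (γ₁ = a⁻² literally).  GAPS G-B5-13: the upper value a⁻² is FALSE for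
large a (exact witnesses: d = 2, L = 3, k = 1, p′ = (π, 0), any even torus, a ≥ 302 — `printed_gamma1_fails`; exact
rational position-space engine: (d, N, L, k, a) = (2, 2, 2, 2, 1000), (2, 2, 3, 1, 1000); float thresholds a* ≈ 26–35
(d = 2), 34–46 (d = 3) on 16- and 8-point tori), TRUE at a = 1 in every tested case (a²λ_max = 1, attained at p′ = 0)
and provably true with γ₁ = (π/2)^{2d+2}a⁻² (`bound145_scalar`).  Not load-bearing: R (1.44) is a-independent and
the series fixes a = 1; consumers needing the VALUE a⁻² must re-open the row.  C-B5-2 (r1): "(2.52)" of [2] does not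
exist; (2.50)–(2.51) are meant. [cite: Balaban1984PropagatorsI, p.26 after (1.45)] -/
def Bounds145Printed {I : Type} (fam : I → ProjFormData) : Prop :=
  ∃ γ₀ : ℝ, 0 < γ₀ ∧ ∀ i : I, ∀ ω : (fam i).Cfg,
    γ₀ * (fam i).nsq ω ≤ (fam i).qf ω ∧ (fam i).qf ω ≤ ((fam i).a ^ 2)⁻¹ * (fam i).nsq ω

/-- The same sentence with the upper constant left as "γ₁(d)·a⁻²" — the form that is provable from (1.45)
(`bound145_scalar`, γ₁ = (π/2)^{2d+2}) and the only form used downstream (a = 1). [cite: Balaban1984PropagatorsI, p.26 after (1.45)] -/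
def Bounds145 {I : Type} (fam : I → ProjFormData) : Prop :=
  ∃ γ₀ γ₁ : ℝ, 0 < γ₀ ∧ 0 < γ₁ ∧ ∀ i : I, ∀ ω : (fam i).Cfg,
    γ₀ * (fam i).nsq ω ≤ (fam i).qf ω ∧ (fam i).qf ω ≤ γ₁ * ((fam i).a ^ 2)⁻¹ * (fam i).nsq ω

/-- the printed sentence implies the γ₁(d)-form with γ₁ = 1. [folklore] -/
theorem bounds145_of_printed {I : Type} (fam : I → ProjFormData) (h : Bounds145Printed fam) : Bounds145 fam := by
  obtain ⟨γ₀, hγ₀, h⟩ := h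
  refine ⟨γ₀, 1, hγ₀, one_pos, fun i ω => ⟨(h i ω).1, ?_⟩⟩
  simpa using (h i ω).2

/-- The arithmetic of the repaired upper bound (G-B5-13).  At a momentum p′ ≠ 0 write (1.45) as
Y/(aX + Δ₀)² with X = Σ_l |u_k(p′+l)|²Δ₀(p′)/Δ(p′+l), Y = Σ_l |u_k(p′+l)|²Δ₀²(p′)/Δ²(p′+l), D = Δ₀(p′) ≥ 0.  Since
Δ(p′+l) ≥ Δ₀(p′) termwise (sinc monotonicity), Y ≤ X; and X ≥ its l = 0 term ≥ c := (2/π)^{2d+2}.  Then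
Y/(aX + D)² ≤ (c a²)⁻¹, i.e. Q′_kG′_k²Q′_k* ≤ (π/2)^{2d+2}a⁻². [folklore] -/
theorem bound145_scalar (a X Y D c : ℝ) (ha : 0 < a) (hc : 0 < c) (hcX : c ≤ X) (hYX : Y ≤ X) (hD : 0 ≤ D) :
    Y / (a * X + D) ^ 2 ≤ (c * a ^ 2)⁻¹ := by
  have hX : 0 < X := lt_of_lt_of_le hc hcX
  have hden : 0 < (a * X + D) ^ 2 := by positivity
  rw [div_le_iff₀ hden]
  have h1 : (c * a ^ 2)⁻¹ * (a * X) ^ 2 ≤ (c * a ^ 2)⁻¹ * (a * X + D) ^ 2 := by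
    apply mul_le_mul_of_nonneg_left _ (by positivity)
    nlinarith [mul_pos ha hX]
  have h2 : (c * a ^ 2)⁻¹ * (a * X) ^ 2 = X ^ 2 / c := by
    field_simp
  have h3 : X ≤ X ^ 2 / c := by
    rw [le_div_iff₀ hc]
    nlinarith
  linarith

/-- G-B5-13, exact witness that the PRINTED value γ₁ = a⁻² fails: d = 2, L = 3, k = 1 (η = 1/3), p′ = (π, 0) (a momentum
of every torus with an even number of unit points per direction).  From (1.31), (1.45) by hand: the three terms
l₁ ∈ {−1, 0, 1} (l₂ = 0 forced by p′₂ = 0) have |u|² = 4/9, 1/9·… precisely |u(p′+l)|² ∈ {4/9, 4/9, 1/9},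
Δ(p′+l) ∈ {9, 9, 36}, Δ₀(p′) = 4, so X = 11/27, Y = 43/243 and a²·(1.45) = a²Y/(aX + 4)² > 1 ⟺ a² − 297a − 1458 > 0
⟺ a > (297 + √94041)/2 ≈ 301.8.  The kernel checks the instance a = 310 (the evaluation of X, Y is the docstring's;
the position-space exact-rational engine confirms the failure independently at (d, N, L, k, a) = (2, 2, 3, 1, 1000)). [folklore] -/
theorem printed_gamma1_fails : (310 : ℚ) ^ 2 * (43 / 243) > ((310 : ℚ) * (11 / 27) + 4) ^ 2 := by
  norm_num

/-! ### D.  The defining properties of H_k (p. 29) and the algebra of (1.95)/(1.103) (pp. 33–34) -/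

/-- Carrier for the properties of H_k: vector fields A on T_η (`CfgA`), fields B on the unit lattice (`CfgB`), the
average Q_k (`Q`), the gauge condition R∂*A = 0 (`gauge`), the energy ½⟨∂A, ∂A⟩ (`energy`) and the operator H_k (`H`,
(1.60)/(1.63)/(1.103)). [cite: Balaban1984PropagatorsI, (1.56)–(1.63) pp.27–29] -/
structure HkData where
  CfgA : Type
  CfgB : Type
  Q : CfgA → CfgB
  gauge : CfgA → Prop
  energy : CfgA → ℝ
  H : CfgB → CfgA

/-- p. 29 [PDF 13], verbatim: *"Using (1.60), or better (1.63), we can verify all the properties of H_kB: Q_kH_kB = B,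
R∂*H_kB = 0, H_kB is a minimum of ½⟨∂A, ∂A⟩ on the set {A : Q_kA = B, R∂*A = 0}, which means that
⟨∂A′, ∂H_kB⟩ = 0 on the set {A′ : Q_kA′ = 0, R∂*A′ = 0}."*  (Census C-B5-9: confirmed numerically against the
constrained minimiser, the KKT system of (1.91)–(1.94) and the explicit (1.60), ≤ 2·10⁻¹², d = 2, 3, 4.) [cite: Balaban1984PropagatorsI, p.29 after (1.63)] -/
def HkPropsPrinted (D : HkData) : Prop :=
  ∀ B : D.CfgB, D.Q (D.H B) = B ∧ D.gauge (D.H B) ∧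
    ∀ A : D.CfgA, D.Q A = B → D.gauge A → D.energy (D.H B) ≤ D.energy A

/-- The bookkeeping of (1.95) R∂*GQ* = 0 and (1.103) H_k = GQ*(QGQ*)⁻¹ (pp. 33–34): with E a right inverse of QGQ*
((1.100): QGQ* is invertible), H := GQ*E satisfies Q H = I and R∂* H = 0 — the first two properties of p. 29 in the
Sect. E representation.  Abstract linear maps (V = vector fields on T_η, W = fields on the unit lattice). [folklore] -/
theorem hk_props {R V W : Type*} [CommRing R] [AddCommGroup V] [Module R V] [AddCommGroup W] [Module R W]
    (G RDs : V →ₗ[R] V) (Q : V →ₗ[R] W) (Qs : W →ₗ[R] V) (E : W →ₗ[R] W)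
    (hE : (Q ∘ₗ G ∘ₗ Qs) ∘ₗ E = LinearMap.id) (h95 : RDs ∘ₗ G ∘ₗ Qs = 0) :
    Q ∘ₗ (G ∘ₗ Qs ∘ₗ E) = LinearMap.id ∧ RDs ∘ₗ (G ∘ₗ Qs ∘ₗ E) = 0 := by
  refine ⟨?_, ?_⟩
  · rw [← hE]
    simp only [LinearMap.comp_assoc]
  · have : RDs ∘ₗ (G ∘ₗ Qs ∘ₗ E) = (RDs ∘ₗ G ∘ₗ Qs) ∘ₗ E := by
      simp only [LinearMap.comp_assoc]
    rw [this, h95, LinearMap.zero_comp]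

/-! ### F.  The proof structure of Proposition 1.2 (pp. 36–40) -/

/-- (1.132) p. 39 "G = G₀ + G₀∂P∂*G" (with Δ_a = G⁻¹ = G₀⁻¹ − ∂P∂*, G₀ = (Δ + aQ*Q)⁻¹, from (1.69)) and (1.133) p. 39
"G₀ = G′ + G′(a_kQ′*Q′ − aQ*Q)G₀" (G₀⁻¹ = G′⁻¹ − (a_kQ′*Q′ − aQ*Q)) are both the resolvent identity: in any ring,
if g₀g₀⁻¹ = 1, g⁻¹g = 1 and g⁻¹ = g₀⁻¹ − x then g = g₀ + g₀xg. [folklore] -/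
theorem resolvent_identity {A : Type*} [Ring A] (g g0 gi g0i x : A)
    (h0 : g0 * g0i = 1) (h1 : gi * g = 1) (hx : gi = g0i - x) : g = g0 + g0 * x * g := by
  have key : g0 * gi * g + g0 * x * g = g0 * g0i * g := by
    rw [hx]; noncomm_ring
  calc g = g0 * g0i * g := by rw [h0, one_mul]
    _ = g0 * gi * g + g0 * x * g := key.symm
    _ = g0 + g0 * x * g := by rw [mul_assoc g0 gi g, h1, mul_one]

/-- (1.122) ⇒ (1.123) p. 37: from Δ_aC₀ = I − R (with Δ_a = G⁻¹) the random-walk representation G = C₀(I − R)⁻¹,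
whenever I − R is invertible ("Of course the sum is convergent only if R is small in a proper sense. This holds if M₀
is sufficiently large."). [folklore] -/
theorem neumann_resummation {A : Type*} [Ring A] (g da c0 r s : A)
    (h1 : g * da = 1) (h3 : da * c0 = 1 - r) (h4 : (1 - r) * s = 1) : g = c0 * s := by
  have hc : c0 = g * (1 - r) := by rw [← h3, ← mul_assoc, h1, one_mul]
  rw [hc, mul_assoc, h4, mul_one]

/-- The decay-extraction step inside (1.131), pp. 38–39: for a walk ω₀, …, ω_n with y within distance c of ω₀ and y′
within distance c of ω_n (c = M₀: y ∈ □_{ω₀}, y′ ∈ □_{ω_n}),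
e^{−2δΣ|ω_i − ω_{i+1}|} ≤ e^{2δc}·e^{−δ|y − y′|}·e^{−δΣ|ω_i − ω_{i+1}|}; with 2δ₀ ≤ M₀⁻¹ (definition of δ₀, p. 38)
the prefactor is ≤ e, and the remaining e^{−δ₀Σ…} is what the text sums into (Σ_{x∈Z^d} e^{−δ₀M₀|x|})ⁿ. [folklore] -/
theorem chain_split {X : Type*} [PseudoMetricSpace X] (f : ℕ → X) (n : ℕ) (y y' : X) (c δ : ℝ)
    (hδ : 0 ≤ δ) (h0 : dist y (f 0) ≤ c) (hn : dist (f n) y' ≤ c) :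
    Real.exp (-(2 * δ * ∑ i ∈ Finset.range n, dist (f i) (f (i + 1)))) ≤
      Real.exp (2 * δ * c) * Real.exp (-(δ * dist y y')) *
        Real.exp (-(δ * ∑ i ∈ Finset.range n, dist (f i) (f (i + 1)))) := by
  set S := ∑ i ∈ Finset.range n, dist (f i) (f (i + 1)) with hS
  have hchain : dist (f 0) (f n) ≤ S := dist_le_range_sum_dist f n
  have htri : dist y y' ≤ 2 * c + S := by
    have := dist_triangle4 y (f 0) (f n) y'
    linarith
  have hmul : δ * dist y y' ≤ δ * (2 * c + S) := mul_le_mul_of_nonneg_left htri hδ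
  rw [← Real.exp_add, ← Real.exp_add]
  apply Real.exp_le_exp.mpr
  linarith

/-- Summability bookkeeping of (1.131): a series Σ_n qⁿ·B with ratio q = O(1)²M₀⁻¹(Σ_x e^{−δ₀M₀|x|}) < 1 is bounded by
B/(1 − q) — "we can fix M₀ depending on d only, such that the series is convergent" (p. 39). [folklore] -/
theorem rw_series_bound (q B : ℝ) (hq0 : 0 ≤ q) (hq1 : q < 1) :
    HasSum (fun n : ℕ => B * q ^ n) (B / (1 - q)) := by
  have h := (hasSum_geometric_of_lt_one hq0 hq1).mul_left B
  simpa [div_eq_mul_inv] using h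

/-- Global Hölder functionals of G not among the `Setting` fields: `hg1 J α` = max(‖∇GJ‖_α, ‖G∇*J‖_α), `e4g J` =
|∇G∇*J| (global sup), `hg2 J α` = ‖∇G∇*J‖_α. [cite: Balaban1984PropagatorsI, (1.108)–(1.109) p.35] -/
structure GlobalH (S : Setting) where
  hg1 : S.Loc → ℝ → ℝ
  e4g : S.Loc → ℝ
  hg2 : S.Loc → ℝ → ℝ

/-- **(1.115)–(1.117)** p. 36 [PDF 20], verbatim: *"The localized inequalities (1.110)–(1.114) imply immediately the
following global inequalities |GJ|, |∇GJ|, |G∇*J|, |ΔGJ|, ‖∇GJ‖_α, ‖G∇*J‖_α ≤ O(1)|J|, (1.115)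
|∇G∇*J| ≤ O(1)(‖J‖_ε + |J|), (1.116)  ‖∇G∇*J‖_α ≤ O(1)(‖J‖_{α+ε} + |J|), (1.117) and (1.89), with the same
dependence of the constants O(1)."*  (|GJ| = sup_y sup_{x∈Δ̃(y)}, so the sup entries are stated per y.) [cite: Balaban1984PropagatorsI, (1.115)–(1.117) p.36] -/
def Global115_117 (S : Setting) (g : GlobalH S) (C : ℝ) (Cα Cε : ℝ → ℝ) (Cαε : ℝ → ℝ → ℝ) : Prop :=
  (∀ (n : Fin 4) (J : S.Loc) (y : S.Site), S.e n J y ≤ C * S.supNorm J) ∧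
  (∀ (α : ℝ) (J : S.Loc), 0 ≤ α → α < 1 → g.hg1 J α ≤ Cα α * S.supNorm J) ∧
  (∀ (ε : ℝ) (J : S.Loc), 0 < ε → ε < 1 → g.e4g J ≤ Cε ε * (S.holder ε J + S.supNorm J)) ∧
  (∀ (α ε : ℝ) (J : S.Loc), 0 ≤ α → 0 < ε → α + ε < 1 →
      g.hg2 J α ≤ Cαε α ε * (S.holder (α + ε) J + S.supNorm J))

/-- The family form of (1.115)–(1.117): constants chosen before the instance (k, T_η). [cite: Balaban1984PropagatorsI, (1.115)–(1.117) p.36] -/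
def Global115_117Fam {I : Type} (fam : I → Setting) (g : ∀ i, GlobalH (fam i)) : Prop :=
  ∃ C : ℝ, ∃ Cα Cε : ℝ → ℝ, ∃ Cαε : ℝ → ℝ → ℝ, 0 < C ∧ ∀ i, Global115_117 (fam i) (g i) C Cα Cε Cαε

/-- **(1.114)** alone (the six localised L² bounds), as a family statement: the part of Prop. 1.2 that p. 39 obtains
FIRST, "from (1.89) with the help of the random walk expansion (1.123) in the same way as the inequality (1.131)". [cite: Balaban1984PropagatorsI, (1.114) p.36 and p.39] -/
def Local114Fam {I : Type} (fam : I → Setting) : Prop :=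
  ∃ δ₀ C : ℝ, 0 < δ₀ ∧ 0 < C ∧ ∀ i, ∀ (n : Fin 6) (J : (fam i).Loc) (ζ : (fam i).Cut) (y y' : (fam i).Site),
    (fam i).cutIn ζ y → (fam i).suppIn J y' →
      (fam i).l2loc n J ζ ≤ C * Real.exp (-(δ₀ * (fam i).dist y y')) * (fam i).cutSup ζ * (fam i).l2Norm J

/-- (1.114) is the fifth block of Prop. 1.2 as typed (`Ineq110_114`). [folklore] -/
theorem local114_of_prop12 {I : Type} (fam : I → Setting) (h : Prop12Printed fam) : Local114Fam fam := by
  obtain ⟨δ₀, C, Cα, Cε, Cαε, hδ, hC, h⟩ := h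
  exact ⟨δ₀, C, hδ, hC, fun i => (h i).2.2.2.2⟩

/-- Carrier for the kernel bounds (1.126)–(1.127): the η-lattice (`X`, `dist` = |x − x′|) and the kernel
(∂P∂*)_{μν}(x, x′) maximised over μ, ν (`ker`). [cite: Balaban1984PropagatorsI, (1.126)–(1.127) p.38] -/
structure KernelData where
  X : Type
  dist : X → X → ℝ
  ker : X → X → ℝ

/-- **(1.126)–(1.127)** p. 38 [PDF 22], verbatim: *"Let us write bounds for the operator ∂P∂*. They follow from the
representation P = G′Q′*(Q′G′²Q′*)⁻¹Q′G′, from Lemma 2.4 of [2], and the representation (1.45) and the analyticity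
method of proving an exponential decay (see the proof of Lemma 2.4 in [2]). We obtain
|(∂P∂*)_{μ,ν}(x, x′)| ≤ O(1)e^{−δ′₀|x−x′|}, (1.126)
(1/|x − x′|^α)|(∂P∂*)_{μ,ν}(x, x″) − (∂P∂*)_{μ,ν}(x′, x″)| ≤ O(1)e^{−δ′₀|x−x″|} for x, x′ : |x − x′| ≤ 1, α < 1. (1.127)
The constant O(1) in (1.126) depends on d only, and in (1.127) it depends on α also (O(1) → ∞ if α → 1)."*
THE BY-METHOD IMPORT of the paper (GAPS C-B5-6 r1 / G-B5-06a): no statement of [2] = B4 covers the kernel of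
G′Q′*(Q′G′²Q′*)⁻¹Q′G′; what is imported is B4's METHOD (Lemma 2.4 + complex translation p′ → p′ + iq, itself
"more troublesome, but equally elementary" and unwritten in B4, G-B4-02/02a), applied to (1.45) with the lower bound
γ₀ of p. 26 surviving the translation.  A LEAF of this module: hypothesis of `prop12_of_printed_steps`. [cite: Balaban1984PropagatorsI, (1.126)–(1.127) p.38] -/
def Kernel126_127Printed {I : Type} (K : I → KernelData) : Prop :=
  ∃ δ₀' C : ℝ, ∃ Cα : ℝ → ℝ, 0 < δ₀' ∧ 0 < C ∧ ∀ i,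
    (∀ x x' : (K i).X, |(K i).ker x x'| ≤ C * Real.exp (-(δ₀' * (K i).dist x x'))) ∧
    (∀ (α : ℝ) (x x' x'' : (K i).X), α < 1 → (K i).dist x x' ≤ 1 →
      |(K i).ker x x'' - (K i).ker x' x''| ≤
        Cα α * (K i).dist x x' ^ α * Real.exp (-(δ₀' * (K i).dist x x'')))

/-- **Prop. 1.2 ⇐ its printed steps**, chained exactly as the text of pp. 36–40 chains them (each step is a
hypothesis shaped as the printed sentence; their analytic content is NOT proved here):
S1 (p. 36 [PDF 20]): *"In the first step we will show that the inequalities (1.115)–(1.117), (1.89) imply the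
proposition"* — by the random-walk expansion (1.118)–(1.123), the commutator bounds (1.120)–(1.121), (1.125),
(1.128)–(1.131) with M₀ = L^{m₀} = M₀(d) large and 2δ₀ = min{δ′₀/3, M₀⁻¹}, USING the leaf (1.126)–(1.127);
S1′ (p. 39 [PDF 23]): (1.114) for G from (1.89) by the same expansion in L²;
S3 (pp. 39–40): Prop. 1.2 for G₀ = (Δ + aQ*Q)⁻¹ via (1.133)–(1.137), G′ from [2] (Lemma 2.4, (2.34)) — family `famG0`;
S2 (p. 39): *"This together with (1.126), (1.127) and (1.89) or (1.114) for G implies immediately (1.115)–(1.117), or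
Proposition 1.2 for G"* via (1.132) G = G₀ + G₀∂P∂*G.
Census C-B5-12: the order S1′ → S3 → S2 → S1 is free of circularity ((1.114) for G needs only (1.89) and the leaf;
the sup/Hölder bounds (1.115)–(1.117) for G then follow from those of G₀ and Cauchy–Schwarz against (1.114)). [cite: Balaban1984PropagatorsI, pp.36–40] -/
theorem prop12_of_printed_steps {I : Type} (fam famG0 : I → Setting) (g : ∀ i, GlobalH (fam i))
    (K : I → KernelData)
    (h11 : Prop11Printed fam)
    (hleaf : Kernel126_127Printed K)
    (S1' : Prop11Printed fam → Kernel126_127Printed K → Local114Fam fam)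
    (S3 : Prop12Printed famG0)
    (S2 : Prop12Printed famG0 → Kernel126_127Printed K → Local114Fam fam → Global115_117Fam fam g)
    (S1 : Global115_117Fam fam g → Prop11Printed fam → Kernel126_127Printed K → Prop12Printed fam) :
    Prop12Printed fam :=
  S1 (S2 S3 hleaf (S1' h11 hleaf)) h11 hleaf

/-- The conclusion block of the paper as one `Prop` (what the citation DAG's leaf `b5` abbreviates): Prop. 1.1,
Prop. 1.2 and the form bounds (1.67), for one family of instances. [cite: Balaban1984PropagatorsI, Props 1.1–1.2 pp.33–36 and (1.67) p.29] -/
def MainBlock {I : Type} (fam : I → Setting) (forms : I → FormData) : Prop :=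
  Prop11Printed fam ∧ Prop12Printed fam ∧ Bounds167 forms

end Literature.MathematicalPhysics.QuantumFieldTheory.Balaban1983to89.B5
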